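import Summits.Ventures.HSemireg.UntwistCocycleTwistEquivalence
import Summits.Ventures.HSemireg.UntwistCocycleTwistLocal
import Literature.AlgebraicGeometry.Modules.LocallyFreeTrace
import HarnessLib

/-!
# Venture HSemireg — the cocycle twist on LOCAL morphisms, `γ : 𝓗om(E, F) → 𝓗om(E ⊗ M, F ⊗ M)`, and its
# compatibility with the unit `𝒪 → 𝓔nd` and the trace `𝓔nd → 𝒪` (th-4 file #16; sequel of #11, #12, #14)

HONEST FRAMING. Sheaf-level module algebra on the tree's real carriers (`Modules/SheafHom`, `Modules/LocallyFreeTrace`)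
for the cocycle twist `F ↦ F⟨c⟩ = F ⊗ lineBundle c` of `UntwistCocycleTwist.lean`. Nothing about any variety; no gerbe;
nothing here says HC, HC_CM or HC_AV is proved.

WHY (route R1.0, untwisted reading `E₀′ = E₀ ⊗ M_B`). After files #11–#15 the ONE binder left in the transport
`IsISemiregular(E) ↔ IsISemiregular(E ⊗ M)` (`UntwistCocycleTwistSigma.lean` §2/§4) is the Leibniz re-expansion `hσ` of
the real `σ_q` through the constructed `θ = Ext(- ⊗ M)`. Its form-degree-`0` row reads `Tr_{E ⊗ M}(θ x) = Tr_E(x)`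
(`σ_0 = Tr : Ext²(E, E) → H²(X, 𝒪_X)`, no Atiyah class). The companion file `UntwistCocycleTwistTrace.lean` (#17) proves
that row on real carriers; the present file supplies its sheaf-level input, which the tree did not have: the twist
functor acts on sections of the INTERNAL Hom, compatibly with unit and trace.

CONTENT (`c : UnitCocycle X`, `E F G : X.Modules`, `U : X.Opens`; namespace `CocycleTwist`):
* `twistMapOver c φ : (E⟨c⟩)|_U ⟶ (F⟨c⟩)|_U` for a LOCAL morphism `φ : E|_U ⟶ F|_U` — componentwise `φ`
  (`(φ⟨c⟩ s)_x = φ(s_x)`; the relation `s_x = g_{xy} s_y` is kept because `φ` is `𝒪_X`-linear and commutes with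
  restriction); additive, `𝒪_X(U)`-linear, functorial (`_comp`, `_id`), compatible with restriction to smaller opens
  (`_restrictHom`) and equal to `UntwistCocycleTwistEquivalence.twistMap` on restrictions of global morphisms
  (`_over_map`);
* `sheafHomTwist c E F : 𝓗om(E, F) ⟶ 𝓗om(E⟨c⟩, F⟨c⟩)` — the morphism of `𝒪_X`-modules `φ ↦ φ⟨c⟩` («`φ ↦ φ ⊗ 1_M`»),
  natural in `F` (`sheafHomMap_comp_sheafHomTwist`: a natural transformation `𝓗om(E, –) ⟶ 𝓗om(E ⊗ M, – ⊗ M)`);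
* `sheafHomUnit_comp_sheafHomTwist` — **`γ` preserves the unit**: `(a · 𝟙_E)⟨c⟩ = a · 𝟙_{E⟨c⟩}`;
* `appLE_twistMapOver_trivSection` — `φ⟨c⟩(e ⊗ t_z) = φ(e) ⊗ t_z` in the local trivialisations of file #14;
* `sheafHomTwist_comp_trace` — **`γ` preserves the trace** of a finite locally free `E`: `tr(φ⟨c⟩) = tr(φ)` — over an
  open `W ⊆ U_z` carrying a frame `b_i` of `E`, the frame `b_i ⊗ t_z` of `E⟨c⟩` gives the same matrix
  (`hom_ext_of_frames_le`: such opens cover `X`).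

Which Ext groups / class / twist (numbers by value at the `g = 4` anchor): these are the sheaf maps behind
`σ_0 : Ext²(E₀, E₀) → H²(X₀, 𝒪)` (source of dimension `18`; target the `h^{0,2} = C(4,2) = 6`-dimensional block of the
`28 = 6 + 16 + 6`-dimensional target `⊕_q H^{q+2}(Ω^q)`), class `tr`, twist `- ⊗ M_B`, `M_B = lineBundle c`.
(v1.1: docstring-only correction of this block's dimension, `6` not `1`; no declaration changed. The consumer is
`UntwistCocycleTwistTrace.lean`, file #17: `Tr_{E ⊗ M}(θ x) = Tr_E(x)` and the unconditional transport of
`0`-semiregularity.)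

## References

* R. Hartshorne, *Algebraic Geometry*, GTM 52 (1977), II.5, II Ex. 1.15, II Ex. 5.1 (internal Hom, trace of a
  locally free sheaf). [Hartshorne1977]
* R.-O. Buchweitz, H. Flenner, *A semiregularity map for modules and applications to deformations*, Compositio
  Math. 137 (2003), §4 (trace maps). [BuchweitzFlenner2003]
* The Stacks Project, Tag 01CM (internal Hom), Tag 01CR (invertible modules). [StacksProject]
-/

noncomputable section

open CategoryTheory AlgebraicGeometry Opposite TopologicalSpace

namespace Summit.Ventures.HSemireg

open Literature.AlgebraicGeometry.Modules Literature.AlgebraicGeometry.Motives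

namespace CocycleTwist

universe u

variable {X : Scheme.{u}} (c : UnitCocycle X) {E F G : X.Modules} {U : X.Opens}

/-! ### The twist functor on LOCAL morphisms `E|_U → F|_U` -/

/-- The components `φ(s_x)` of the twist of a local morphism satisfy the twisting relation (`φ` is
`𝒪_X`-linear and commutes with restriction). [folklore] -/
theorem appLE_comp_mem_twistFamilies (φ : E.over U ⟶ F.over U) {V : X.Opens} (k : V ⟶ U)
    (s : Γ(twist c E, V)) :
    (fun x => appLE φ (homOfLE (inf_le_left.trans k.le) : V ⊓ c.U x ⟶ U) (comp c E s x)) ∈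
      twistFamilies c F V := by
  intro x y W hW hx hy
  change F.presheaf.map _ (appLE φ _ (comp c E s x)) = _ • F.presheaf.map _ (appLE φ _ (comp c E s y))
  rw [← appLE_map, ← appLE_map, comp_rel c E s x y hW hx hy, appLE_smul_right]
  congr 1

/-- The twist `φ⟨c⟩(s) = (φ(s_x))_x` of a local morphism `φ : E|_U → F|_U` on a section `s` of `E⟨c⟩` over
`V ≤ U`. [folklore] -/
def twistMapOverSection (φ : E.over U ⟶ F.over U) {V : X.Opens} (k : V ⟶ U) (s : Γ(twist c E, V)) :
    Γ(twist c F, V) :=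
  mkFamily c F _ (appLE_comp_mem_twistFamilies c φ k s)

/-- Components of `φ⟨c⟩(s)`: `φ(s_x)`. [folklore] -/
@[simp]
theorem comp_twistMapOverSection (φ : E.over U ⟶ F.over U) {V : X.Opens} (k : V ⟶ U)
    (s : Γ(twist c E, V)) (x : X) :
    comp c F (twistMapOverSection c φ k s) x =
      appLE φ (homOfLE (inf_le_left.trans k.le) : V ⊓ c.U x ⟶ U) (comp c E s x) := rfl

/-- `φ⟨c⟩(0) = 0`. [folklore] -/
theorem twistMapOverSection_zero (φ : E.over U ⟶ F.over U) {V : X.Opens} (k : V ⟶ U) :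
    twistMapOverSection c φ k (0 : Γ(twist c E, V)) = 0 :=
  twist_ext c F fun x => by rw [comp_twistMapOverSection, comp_zero, comp_zero, appLE_zero_right]

/-- `φ⟨c⟩` is additive on sections. [folklore] -/
theorem twistMapOverSection_add (φ : E.over U ⟶ F.over U) {V : X.Opens} (k : V ⟶ U)
    (s t : Γ(twist c E, V)) :
    twistMapOverSection c φ k (s + t) = twistMapOverSection c φ k s + twistMapOverSection c φ k t :=
  twist_ext c F fun x => by
    rw [comp_twistMapOverSection, comp_add, comp_add, comp_twistMapOverSection, comp_twistMapOverSection,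
      appLE_add_right]

/-- `φ⟨c⟩` is `𝒪_X(V)`-linear on sections. [folklore] -/
theorem twistMapOverSection_smul (φ : E.over U ⟶ F.over U) {V : X.Opens} (k : V ⟶ U) (r : Γ(X, V))
    (s : Γ(twist c E, V)) :
    twistMapOverSection c φ k (r • s) = r • twistMapOverSection c φ k s :=
  twist_ext c F fun x => by
    rw [comp_twistMapOverSection, comp_smul, comp_smul, comp_twistMapOverSection, appLE_smul_right]

/-- `φ⟨c⟩` commutes with restriction on sections. [folklore] -/
theorem twistMapOverSection_map (φ : E.over U ⟶ F.over U) {V V' : X.Opens} (k : V ⟶ U) (i : V' ⟶ V)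
    (s : Γ(twist c E, V)) :
    (twist c F).presheaf.map i.op (twistMapOverSection c φ k s) =
      twistMapOverSection c φ (i ≫ k) ((twist c E).presheaf.map i.op s) :=
  twist_ext c F fun x => by
    rw [comp_map_hom, comp_twistMapOverSection, comp_twistMapOverSection, comp_map_hom, ← appLE_map]
    exact appLE_congr_hom _ _ _ _

/-- **`φ⟨c⟩ : (E⟨c⟩)|_U → (F⟨c⟩)|_U` for a LOCAL morphism `φ : E|_U → F|_U`** — the twist functor `- ⊗ M` on
morphisms of restricted modules (componentwise `φ`; `UntwistCocycleTwistEquivalence.twistMap` is the case `U = X`).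
[folklore] -/
def twistMapOver (φ : E.over U ⟶ F.over U) : (twist c E).over U ⟶ (twist c F).over U where
  val := PresheafOfModules.homMk
    { app := fun V => AddCommGrpCat.ofHom
        { toFun := fun s => (twistMapOverSection c φ V.unop.hom s : Γ(twist c F, V.unop.left))
          map_zero' := twistMapOverSection_zero c φ _
          map_add' := fun s t => twistMapOverSection_add c φ _ s t }
      naturality := fun {V V'} i => by
        ext s
        change twistMapOverSection c φ V'.unop.hom ((twist c E).presheaf.map i.unop.left.op s) =
          (twist c F).presheaf.map i.unop.left.op (twistMapOverSection c φ V.unop.hom s)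
        rw [twistMapOverSection_map]
        rfl }
    (fun V (r : Γ(X, V.unop.left)) (s : Γ(twist c E, V.unop.left)) => by
      change twistMapOverSection c φ V.unop.hom (r • s) = r • twistMapOverSection c φ V.unop.hom s
      exact twistMapOverSection_smul c φ V.unop.hom r s)

/-- Values of `φ⟨c⟩`. [folklore] -/
@[simp]
theorem appLE_twistMapOver (φ : E.over U ⟶ F.over U) {V : X.Opens} (k : V ⟶ U) (s : Γ(twist c E, V)) :
    appLE (twistMapOver c φ) k s = twistMapOverSection c φ k s := rfl

/-- `0⟨c⟩ = 0` (local morphisms). [folklore] -/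
theorem twistMapOver_zero : twistMapOver c (0 : E.over U ⟶ F.over U) = 0 :=
  hom_ext_of_appLE fun W k s => twist_ext c F fun x => by
    rw [appLE_twistMapOver, comp_twistMapOverSection, appLE_zero, appLE_zero, comp_zero]

/-- `(φ + ψ)⟨c⟩ = φ⟨c⟩ + ψ⟨c⟩` (local morphisms). [folklore] -/
theorem twistMapOver_add (φ ψ : E.over U ⟶ F.over U) :
    twistMapOver c (φ + ψ) = twistMapOver c φ + twistMapOver c ψ :=
  hom_ext_of_appLE fun W k s => twist_ext c F fun x => by
    rw [appLE_add, comp_add, appLE_twistMapOver, appLE_twistMapOver, appLE_twistMapOver,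
      comp_twistMapOverSection, comp_twistMapOverSection, comp_twistMapOverSection, appLE_add]

/-- `(a • φ)⟨c⟩ = a • φ⟨c⟩` for `a ∈ Γ(X, U)` (local morphisms). [folklore] -/
theorem twistMapOver_smul (a : Γ(X, U)) (φ : E.over U ⟶ F.over U) :
    twistMapOver c (a • φ) = a • twistMapOver c φ :=
  hom_ext_of_appLE fun W k s => twist_ext c F fun x => by
    rw [appLE_smul, comp_smul, appLE_twistMapOver, appLE_twistMapOver, comp_twistMapOverSection,
      comp_twistMapOverSection, appLE_smul, ← CategoryTheory.comp_apply, ← Functor.map_comp]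
    rfl

/-- `(φ ≫ ψ)⟨c⟩ = φ⟨c⟩ ≫ ψ⟨c⟩` (local morphisms). [folklore] -/
theorem twistMapOver_comp (φ : E.over U ⟶ F.over U) (ψ : F.over U ⟶ G.over U) :
    twistMapOver c (φ ≫ ψ) = twistMapOver c φ ≫ twistMapOver c ψ :=
  hom_ext_of_appLE fun W k s => twist_ext c G fun x => by
    rw [appLE_comp, appLE_twistMapOver, appLE_twistMapOver, appLE_twistMapOver, comp_twistMapOverSection,
      comp_twistMapOverSection, comp_twistMapOverSection, appLE_comp]

/-- `𝟙⟨c⟩ = 𝟙` (local morphisms). [folklore] -/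
theorem twistMapOver_id : twistMapOver c (𝟙 (E.over U)) = 𝟙 ((twist c E).over U) :=
  hom_ext_of_appLE fun W k s => twist_ext c E fun x => by
    rw [appLE_twistMapOver, comp_twistMapOverSection, appLE_id, appLE_id]

/-- Twisting commutes with restricting local morphisms to smaller opens. [folklore] -/
theorem twistMapOver_restrictHom {V : X.Opens} (i : V ⟶ U) (φ : E.over U ⟶ F.over U) :
    twistMapOver c (restrictHom i φ) = restrictHom i (twistMapOver c φ) :=
  hom_ext_of_appLE fun W k s => twist_ext c F fun x => by
    rw [appLE_twistMapOver, appLE_restrictHom, appLE_twistMapOver, comp_twistMapOverSection,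
      comp_twistMapOverSection, appLE_restrictHom]
    exact appLE_congr_hom _ _ _ _

/-- On restrictions `f|_U` of global morphisms the local twist is the global one: `(f|_U)⟨c⟩ = (f⟨c⟩)|_U`.
[folklore] -/
theorem twistMapOver_over_map (f : E ⟶ F) :
    twistMapOver c ((SheafOfModules.overFunctor _ U).map f) =
      (SheafOfModules.overFunctor _ U).map (twistMap c f) :=
  hom_ext_of_appLE fun W k s => twist_ext c F fun x => by
    rw [appLE_twistMapOver, comp_twistMapOverSection, appLE_over_map, appLE_over_map, comp_twistMap_app]

/-! ### `γ_F : 𝓗om(E, F) ⟶ 𝓗om(E ⊗ M, F ⊗ M)`, natural in `F` -/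

variable (E F) in
/-- **`γ_F : 𝓗om(E, F) ⟶ 𝓗om(E⟨c⟩, F⟨c⟩)`**, `φ ↦ φ⟨c⟩` on sections over every open (`𝓗om(E, F) → 𝓗om(E ⊗ M, F ⊗ M)`,
`φ ↦ φ ⊗ 1_M`). [folklore] -/
def sheafHomTwist : sheafHom E F ⟶ sheafHom (twist c E) (twist c F) where
  val := PresheafOfModules.homMk
    { app := fun U => AddCommGrpCat.ofHom
        { toFun := fun φ : E.over U.unop ⟶ F.over U.unop => twistMapOver c φ
          map_zero' := twistMapOver_zero c
          map_add' := fun φ ψ => twistMapOver_add c φ ψ }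
      naturality := fun {U V} i => by
        refine AddCommGrpCat.ext fun (φ : E.over U.unop ⟶ F.over U.unop) => ?_
        change twistMapOver c (restrictHom i.unop φ) = restrictHom i.unop (twistMapOver c φ)
        exact twistMapOver_restrictHom c i.unop φ }
    (fun U (a : Γ(X, U.unop)) (φ : E.over U.unop ⟶ F.over U.unop) => by
      change twistMapOver c (a • φ) = a • twistMapOver c φ
      exact twistMapOver_smul c a φ)

/-- Sections of `γ_F`: `φ ↦ φ⟨c⟩`. [folklore] -/
@[simp]
theorem sheafHomTwist_app_apply (E F : X.Modules) (U : X.Opens) (φ : E.over U ⟶ F.over U) :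
    (sheafHomTwist c E F).app U φ = twistMapOver c φ := rfl

/-- `γ` is natural in `F`: `𝓗om(E, f) ≫ γ_{F'} = γ_F ≫ 𝓗om(E⟨c⟩, f⟨c⟩)`. [folklore] -/
theorem sheafHomMap_comp_sheafHomTwist {F' : X.Modules} (f : F ⟶ F') :
    sheafHomMap E f ≫ sheafHomTwist c E F' = sheafHomTwist c E F ≫ sheafHomMap (twist c E) (twistMap c f) := by
  refine Scheme.Modules.hom_ext _ _ fun U => AddCommGrpCat.ext fun (φ : E.over U ⟶ F.over U) => ?_
  change twistMapOver c (φ ≫ (SheafOfModules.overFunctor _ U).map f) =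
    twistMapOver c φ ≫ (SheafOfModules.overFunctor _ U).map (twistMap c f)
  rw [twistMapOver_comp, twistMapOver_over_map]

/-! ### Compatibility of `γ` with the unit `𝒪 → 𝓔nd` and with the trace `𝓔nd → 𝒪` -/

variable (E) in
/-- **`γ` preserves the unit**: `(a ↦ a · 𝟙_E) ≫ γ_E = (a ↦ a · 𝟙_{E⟨c⟩})` (`(a · 𝟙)⟨c⟩ = a · 𝟙`). [folklore] -/
theorem sheafHomUnit_comp_sheafHomTwist : sheafHomUnit E ≫ sheafHomTwist c E E = sheafHomUnit (twist c E) := by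
  refine Scheme.Modules.hom_ext _ _ fun U => AddCommGrpCat.ext fun (a : Γ(X, U)) => ?_
  change twistMapOver c ((sheafHomUnit E).app U a) = (sheafHomUnit (twist c E)).app U a
  rw [sheafHomUnit_app_apply, sheafHomUnit_app_apply]
  refine hom_ext_of_appLE fun W k s => twist_ext c E fun x => ?_
  rw [appLE_twistMapOver, comp_twistMapOverSection, appLE_overScalar, appLE_overScalar, comp_smul,
    ← CategoryTheory.comp_apply, ← Functor.map_comp]
  rfl

/-- **`φ⟨c⟩(e ⊗ t_z) = φ(e) ⊗ t_z`**: the local twist in the local trivialisations `trivSection` of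
`UntwistCocycleTwistLocal` (over `V ≤ U_z`; `φ` is `𝒪_X`-linear). [folklore] -/
theorem appLE_twistMapOver_trivSection (φ : E.over U ⟶ F.over U) {V : X.Opens} (k : V ⟶ U) (z : X)
    (hV : V ≤ c.U z) (e : Γ(E, V)) :
    appLE (twistMapOver c φ) k (trivSection c E z hV e) = trivSection c F z hV (appLE φ k e) :=
  twist_ext c F fun x => by
    rw [appLE_twistMapOver, comp_twistMapOverSection, comp_trivSection, comp_trivSection, appLE_smul_right,
      ← appLE_map]
    congr 1

/-- Basis sections of a frame `f ≫ t` transported along an isomorphism `t : E|_W ≅ E'|_W` of RESTRICTED modules: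
the images `t(b_i)`. [folklore] -/
theorem basisSection_trans_over {E' : X.Modules} {W : X.Opens} {I : Type u} (f : SheafOfModules.free I ≅ E.over W)
    (t : E.over W ≅ E'.over W) (i : I) : basisSection (f ≪≫ t) i = appLE t.hom (𝟙 W) (basisSection f i) := by
  rw [basisSection, basisSection, Iso.trans_hom, SheafOfModules.freeHomEquiv_comp_apply,
    overSectionsEquiv_sectionsMap']

/-- Dual basis of the transported frame: `t⁻¹ ≫ λ_i`. [folklore] -/
theorem dualBasis_trans_over {E' : X.Modules} {W : X.Opens} {I : Type u} (f : SheafOfModules.free I ≅ E.over W)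
    (t : E.over W ≅ E'.over W) (i : I) : dualBasis (f ≪≫ t) i = t.inv ≫ dualBasis f i :=
  Category.assoc _ _ _

/-- `(e ⊗ t_z)_z`-extraction inverts `e ↦ e ⊗ t_z` on sections (the two halves of `twistTrivOver`). [folklore] -/
theorem appLE_twistTrivOver_inv_trivSection (z : X) (W : X.Opens) (hW : W ≤ c.U z) (m : Γ(E, W)) :
    appLE (twistTrivOver c E z W hW).inv (𝟙 W) (trivSection c E z ((𝟙 W).le.trans hW) m) = m := by
  have h := congrArg (fun ψ => appLE ψ (𝟙 W) m) (twistTrivOver c E z W hW).hom_inv_id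
  rw [appLE_comp, appLE_id] at h
  exact h

variable (E) in
/-- Locality for morphisms out of an internal Hom, refined by the cover of the cocycle: two morphisms
`𝓗om(A, M) → G` agree if they agree on sections over every open `W` carrying a finite frame of `E` AND contained
in a member `U_z` of the cover of `c` (such opens cover `X`). [folklore] -/
theorem hom_ext_of_frames_le (hE : IsFiniteLocallyFree E) {A M G : X.Modules} {α β : sheafHom A M ⟶ G}
    (h : ∀ ⦃W : X.Opens⦄ ⦃I : Type u⦄ [Fintype I] (_f : SheafOfModules.free I ≅ E.over W) (z : X) (_hW : W ≤ c.U z)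
      (ψ : A.over W ⟶ M.over W), α.app W ψ = β.app W ψ) : α = β := by
  refine Scheme.Modules.hom_ext _ _ fun U => AddCommGrpCat.ext fun (φ : A.over U ⟶ M.over U) => ?_
  refine TopCat.Sheaf.eq_of_locally_eq' ((SheafOfModules.toSheaf _).obj G)
    (fun x : U => piece hE U x ⊓ c.U x.1) U (fun x => homOfLE (inf_le_left.trans inf_le_left))
    (fun y hy => Opens.mem_iSup.2 ⟨⟨y, hy⟩, ⟨hy, mem_trivNbhd hE y⟩, c.mem y⟩) _ _ fun x => ?_
  change G.presheaf.map (homOfLE _).op (α.app U φ) = G.presheaf.map (homOfLE _).op (β.app U φ)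
  rw [← Scheme.Modules.Hom.app_map_apply, ← Scheme.Modules.Hom.app_map_apply]
  exact h (SheafOfModules.restrictTrivialisation (R := X.ringCatSheaf)
    (homOfLE (inf_le_left : piece hE U x ⊓ c.U x.1 ≤ piece hE U x)) (pieceFrame hE x)) x.1 inf_le_right _

variable (E) in
/-- **`γ` preserves the trace**: `γ_E ≫ tr_{E⟨c⟩} = tr_E`, i.e. `tr(φ⟨c⟩) = tr(φ)` for every local endomorphism
`φ` of `E` — in a frame `b_i` of `E` over `W ≤ U_z` and the frame `b_i ⊗ t_z` of `E⟨c⟩` both traces are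
`∑_i λ_i(φ(b_i))` (`φ⟨c⟩(b_i ⊗ t_z) = φ(b_i) ⊗ t_z`). [folklore] -/
theorem sheafHomTwist_comp_trace (hE : IsFiniteLocallyFree E) :
    sheafHomTwist c E E ≫ trace (isFiniteLocallyFree_twist c hE) = trace hE := by
  refine hom_ext_of_frames_le c E hE fun W I _ f z hW ψ => ?_
  change (trace (isFiniteLocallyFree_twist c hE)).app W (twistMapOver c ψ) = (trace hE).app W ψ
  rw [trace_app_eq_sum hE f, trace_app_eq_sum (isFiniteLocallyFree_twist c hE) (f ≪≫ twistTrivOver c E z W hW)]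
  refine Finset.sum_congr rfl fun i _ => ?_
  rw [basisSection_trans_over, dualBasis_trans_over, appLE_comp]
  change appLE (dualBasis f i) (𝟙 W) (appLE (twistTrivOver c E z W hW).inv (𝟙 W)
    (appLE (twistMapOver c ψ) (𝟙 W) (appLE (toTwistOver c E z W hW) (𝟙 W) (basisSection f i)))) = _
  rw [appLE_toTwistOver, appLE_twistMapOver_trivSection, appLE_twistTrivOver_inv_trivSection]

end CocycleTwist

end Summit.Ventures.HSemireg

end
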